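import Mathlib
import Summits.ValiantsHypothesis.ValiantsHypothesis.Theorems.FifoMatchingNNDivisionHardFewGeneratorsExp
import Summits.ValiantsHypothesis.ValiantsHypothesis.Theorems.FifoMatchingNNDivisionHardFewFlatsRung
import HarnessLib

/-!
# ★★★ `NNDivisionHard` ON COFACTORS WHOSE SUPPORT LIES ON FEW PARALLEL LOW-DIMENSIONAL FLATS — the PARALLEL-FLATS RUNG at the
# route rate and in the crux's currency (crux `Theses.FifoMatching.NNDivisionHard`, stmt-ValiantsHypothesis-21181)

WHAT IS NEW.  In the NN currency the tree decides cofactors `hh` whose Newton polytope has at most `2^{κ√n}` GENERATORS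
(✓ `…FewGeneratorsExp.nnDivisionHard_fewGeneratorsExp`, PROP A) and cofactors of Newton DIMENSION `≤ κ√n`
(✓ `…LowDimRate.nnDivisionHard_lowdim`, the DIMENSION RUNG) — two incomparable tiers.  With the PARALLEL-FLATS RUNG
(✓ `…FewFlatsRung.corPolytopeGraph_top_add_hull_three_pow_le_of_flats`: `3^{h − dim V} ≤ |T|·(r+1)·2^{h − dim V}` for passengers
whose generators lie on `|T|` parallel translates of `V`) this file decides their common generalisation:

* `transport_step_flats`, ★ `transport_geometric_flats` — the K1/AFHMS located-face transport `Newt(NN_n) + Q ⟶ COR(K_h) + Q'`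
  carried WITH THE FLAT STRUCTURE `(π : J → T, V)`: each step replaces the passenger by a linear image of the hull of its maximising
  generators, so the labels restrict and `V ↦ L(V)` (count and dimension do not grow).
* ★★ `corMinkowskiHard_fewFlats` — COR level, route rate: eventually in `h`, `2·dim V ≤ h` and `|T|·2^{⌈(h/2)/2⌉} ≤ 3^{⌈(h/2)/2⌉}`
  force `xc(COR(K_h) + conv q) > 2^((log₂ h + c)^c)`.
* ★★★ `nnDivisionHard_fewFlatsExp` — `∃ κ > 0 ∀ c`, eventually in `n`, EVERY `hh ≠ 0` over `ℝ≥0` whose Newton polytope is generated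
  by a family `q₀ : J → ℝ^{2n×2n}` lying on at most `2^{κ√n}` parallel translates of a direction space of dimension `≤ κ√n` satisfies
  the crux's literal inequality `2^((log₂ n + c)^c) < L₊(NN_n · hh) + L₊(hh)` — any degrees.  `V = 0`: the generator-count tier;
  one flat: the dimension tier.
* ★★★ `nnDivisionHard_mul_fewMonomials_lowdim` — the headline member: PRODUCTS `hh = p · q` with `|supp p| ≤ 2^{κ√n}` and
  `dim aff supp q ≤ κ√n` (any degrees of either factor).  `Newt(p·q) = Newt p + Newt q` may have `|supp p| · #vert Newt q`
  vertices and dimension `dim Newt p + dim Newt q`: NEITHER tier alone decides this class.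

MECHANISM: the transport of ✓ `…FewGeneratorsTransport` / ✓ `…LowDimRate` (K1's located face `queueGridZeroOnePoints_holds`, c1's
`corMap_image_queueGridPP`, AFHMS's clique face `AboulkerEtAl2019_gridCorCliqueFace`; faces and linear images distribute over
Minkowski sums) with the pair `(π, V)` threaded through; the rate plumbing of ✓ `…FewGeneratorsExp` verbatim (`three_pow_half_le`,
`card_side_condition`, `growth_eventually`, `T_pow_four_le`).  No definitions, no named facts, no sorry.

HONEST FRAMING: a restriction theorem (a decided sub-class of cofactors), NOT the crux: stmt-21181 `NNDivisionHard` (all cofactors)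
is OPEN — the survivors are cheap cofactors whose supports need exponentially many parallel low-dimensional flats; COR-MINKOWSKI /
COR-VIRTUAL OPEN; `NNNotVP` OPEN; `VP ≠ VNP` NOT proved; nothing here is a summit statement.  References: Hrubeš–Yehudayoff 2021 §6
Problem 2 [HrubesYehudayoff2021]; Fiorini et al. 2015 Thm 7 [FioriniEtAl2015]; Kaibel–Weltge 2015 Thm 1 [KaibelWeltge2014]; AFHMS
2019 [AboulkerEtAl2019 = arXiv:1806.00541].
-/

set_option autoImplicit false

-- the mandated summit-side namespace repeats a component by design (single-problem summit)
set_option linter.dupNamespace false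

noncomputable section

open Matrix Finset
open scoped Pointwise

namespace Summit.ValiantsHypothesis.ValiantsHypothesis.Theorems.FifoMatching

namespace FewFlats

open Literature.Barriers.PneNP (HasEFOfSize sum_dotProduct_le_sum_of_valid inter_eqs_eq_inter_sum_of_valid)
open Literature.Combinatorics.Optimization (corPolytopeGraph)
open Summit.ValiantsHypothesis.ValiantsHypothesis.Theorems.FifoMatching.XcDivision
open Summit.ValiantsHypothesis.ValiantsHypothesis.Theorems.FifoMatching.LowDim (newt_inter_zeroSet_eq three_two_descend adim)
open Summit.ValiantsHypothesis.ValiantsHypothesis.Theorems.FifoMatching.FewGenerators (three_pow_half_le card_side_condition)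
open MvPolynomial
open scoped NNReal
open Literature.Computability.AlgebraicComplexity (complexity nestFreeMatchingPoly)
open Literature.Computability.AlgebraicComplexity.MonotoneCircuitEF (hasEFOfSize_newtonPolytope_complexity)
open Literature.Algebra.Polynomial.NewtonPolytope (newtonPolytope newtonPolytope_mul)
open Summit.ValiantsHypothesis.ValiantsHypothesis.Theorems.FifoMatching.QueueGridFace
  (realOf suppPts newt QGV patternVec queueGridPP corMap corMap_image_queueGridPP newt_nonneg growth_eventually)
open Summit.ValiantsHypothesis.ValiantsHypothesis.Theorems.FifoMatching.GridCorShadow (queueGridZeroOnePoints_holds)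
open Summit.ValiantsHypothesis.ValiantsHypothesis.Theorems.FifoMatching.MonomialCofactor (newt_eq_newtonPolytope)
open Literature.Combinatorics.Optimization (AboulkerEtAl2019_gridCorCliqueFace)

/-! ## §1 The transport WITH the flat structure `(π, V)` -/

/-- a nonempty finite type is `Fin (K + 1)` for some `K`. [folklore] -/
theorem exists_equiv_fin_succ (S : Type) [Fintype S] [Nonempty S] : ∃ K : ℕ, Nonempty (S ≃ Fin (K + 1)) := by
  obtain ⟨K, hK⟩ := Nat.exists_eq_succ_of_ne_zero (Fintype.card_ne_zero (α := S))
  exact ⟨K, ⟨(Fintype.equivFin S).trans (finCongr hK)⟩⟩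

/-- **ONE TRANSPORT STEP, with the flat structure**: if `P + conv{q j}` has an extended formulation of size `r`, the generators
are labelled by `π : J → T` with `q j − q j' ∈ V` for equal labels, `w · x ≤ δ` is valid on `P` and `L` is linear, then
`L(P ∩ {w · x = δ}) + conv{q'}` has an extended formulation of size `r` for a family `q'` (the `L`-images of the `w`-maximising
`q j`) labelled in the same `T` with differences in a space `V'`, `dim V' ≤ dim V`. [cite: FioriniEtAl2015, Lemma 9] -/
theorem transport_step_flats {ι κ J T : Type} [Fintype ι] [Fintype κ] [Fintype J] [Nonempty J]
    {P : Set (ι → ℝ)} (q : J → ι → ℝ) (π : J → T) (V : Submodule ℝ (ι → ℝ))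
    (hV : ∀ j j', π j = π j' → q j - q j' ∈ V) {r : ℕ}
    (h : HasEFOfSize (P + convexHull ℝ (Set.range q)) r)
    (w : ι → ℝ) (δ : ℝ) (hP : ∀ x ∈ P, w ⬝ᵥ x ≤ δ) (L : (ι → ℝ) →ₗ[ℝ] (κ → ℝ)) :
    ∃ (K : ℕ) (q' : Fin (K + 1) → κ → ℝ) (π' : Fin (K + 1) → T) (V' : Submodule ℝ (κ → ℝ)),
      HasEFOfSize (L '' (P ∩ {x | w ⬝ᵥ x = δ}) + convexHull ℝ (Set.range q')) r ∧
        (∀ j j', π' j = π' j' → q' j - q' j' ∈ V') ∧ Module.finrank ℝ ↥V' ≤ Module.finrank ℝ ↥V := by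
  classical
  obtain ⟨j₀, -, hj₀⟩ :=
    Finset.exists_max_image Finset.univ (fun j => w ⬝ᵥ q j) Finset.univ_nonempty
  have hle : ∀ j, w ⬝ᵥ q j ≤ w ⬝ᵥ q j₀ := fun j => hj₀ j (Finset.mem_univ _)
  have hQ : ∀ y ∈ convexHull ℝ (Set.range q), w ⬝ᵥ y ≤ w ⬝ᵥ q j₀ :=
    dot_le_of_mem_convexHull _ w _ (by rintro _ ⟨j, rfl⟩; exact hle j)
  have h2 := hasEFOfSize_image_add (h.face_add_face₁ w δ _ hP hQ) L
  rw [convexHull_range_inter_eq q w _ hle, LinearMap.image_convexHull, ← Set.range_comp] at h2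
  haveI : Nonempty {j : J // w ⬝ᵥ q j = w ⬝ᵥ q j₀} := ⟨⟨j₀, rfl⟩⟩
  obtain ⟨K, ⟨e⟩⟩ := exists_equiv_fin_succ {j : J // w ⬝ᵥ q j = w ⬝ᵥ q j₀}
  refine ⟨K, (⇑L ∘ fun j : {j : J // w ⬝ᵥ q j = w ⬝ᵥ q j₀} => q j.1) ∘ ⇑e.symm,
    fun j => π (e.symm j).1, V.map L, ?_, ?_, Submodule.finrank_map_le L V⟩
  · have hr : Set.range ((⇑L ∘ fun j : {j : J // w ⬝ᵥ q j = w ⬝ᵥ q j₀} => q j.1) ∘ ⇑e.symm) =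
        Set.range (⇑L ∘ fun j : {j : J // w ⬝ᵥ q j = w ⬝ᵥ q j₀} => q j.1) :=
      e.symm.surjective.range_comp _
    rw [hr]; exact h2
  · intro j j' hπ
    refine ⟨q (e.symm j).1 - q (e.symm j').1, hV _ _ hπ, ?_⟩
    simp only [Function.comp_apply, map_sub]

/-- ★ **THE GEOMETRIC TRANSPORT WITH THE FLAT STRUCTURE (PROVED)**: as `FewGenerators.transport_geometric_card` /
`LowDim.transport_geometric_dim`, for an ARBITRARY finitely generated passenger `conv{q₀ j}` of `Newt(NN_n)` labelled by `π : J → T`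
with equal-label differences in `V`: with AFHMS's constants `c, t₀`, for `r ≥ 1`, `n ≥ (r+1)(2r+1)`, `2g ≤ r`, `g ≥ t₀` and every
size-`s` extended formulation of `Newt(NN_n) + conv{q₀}` there are `h ≥ c·g` and a family `q : Fin (K+1) → ℝ^{h×h}` labelled in `T`
with equal-label differences in some `V'`, `dim V' ≤ dim V`, and a size-`s` extended formulation of `COR(K_h) + conv{q}`.
[cite: AboulkerEtAl2019, pp. 5–6 (grid-minor clique face)] [cite: FioriniEtAl2015, Lemma 9] -/
theorem transport_geometric_flats :
    ∃ c : ℝ, 0 < c ∧ ∃ t₀ : ℕ, ∀ (n r g : ℕ), 1 ≤ r → (r + 1) * (2 * r + 1) ≤ n → ∀ (hg : 2 * g ≤ r), t₀ ≤ g →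
      ∀ {J T : Type} [Fintype J] [Nonempty J] (q₀ : J → (Fin (2 * n) × Fin (2 * n)) → ℝ) (π : J → T)
        (V : Submodule ℝ ((Fin (2 * n) × Fin (2 * n)) → ℝ)), (∀ j j', π j = π j' → q₀ j - q₀ j' ∈ V) → ∀ (s : ℕ),
        HasEFOfSize (newt (nestFreeMatchingPoly n ℝ≥0) + convexHull ℝ (Set.range q₀)) s →
          ∃ h : ℕ, c * g ≤ h ∧ ∃ (K : ℕ) (q : Fin (K + 1) → (Fin h × Fin h → ℝ)) (π' : Fin (K + 1) → T)
            (V' : Submodule ℝ (Fin h × Fin h → ℝ)),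
            HasEFOfSize (corPolytopeGraph (⊤ : SimpleGraph (Fin h)) + convexHull ℝ (Set.range q)) s ∧
              (∀ j j', π' j = π' j' → q j - q j' ∈ V') ∧ Module.finrank ℝ ↥V' ≤ Module.finrank ℝ ↥V := by
  classical
  obtain ⟨c, hc, t₀, hface⟩ := AboulkerEtAl2019_gridCorCliqueFace
  refine ⟨c, hc, t₀, fun n r g hr hn hg ht J T _ _ q₀ π V hV s hEF' => ?_⟩
  -- Step 1: the A1 coordinate face, read out onto `PP_r`
  obtain ⟨Z, f, hA1⟩ := queueGridZeroOnePoints_holds r n hr hn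
  let w : (Fin (2 * n) × Fin (2 * n)) → ℝ := fun e => if e ∈ Z then (-1 : ℝ) else 0
  have hw : ∀ x : (Fin (2 * n) × Fin (2 * n)) → ℝ, w ⬝ᵥ x = -∑ e ∈ Z, x e := by
    intro x
    simp only [dotProduct, w, ite_mul, neg_one_mul, zero_mul]
    rw [Finset.sum_ite_mem, Finset.univ_inter, Finset.sum_neg_distrib]
  have hP : ∀ x ∈ newt (nestFreeMatchingPoly n ℝ≥0), w ⬝ᵥ x ≤ 0 := fun x hx => by
    rw [hw]; exact neg_nonpos.2 (Finset.sum_nonneg fun e _ => newt_nonneg _ x hx e)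
  let Lf : ((Fin (2 * n) × Fin (2 * n)) → ℝ) →ₗ[ℝ] ((QGV r × QGV r) × Bool × Bool → ℝ) :=
    LinearMap.funLeft ℝ ℝ f
  obtain ⟨K₁, q₁, π₁, V₁, h₁, hV₁, hd₁⟩ := transport_step_flats q₀ π V hV hEF' w 0 hP Lf
  have hF : Lf '' (newt (nestFreeMatchingPoly n ℝ≥0) ∩ {x | w ⬝ᵥ x = 0}) = queueGridPP r := by
    rw [newt_inter_zeroSet_eq, LinearMap.image_convexHull]
    unfold queueGridPP
    congr 1
  rw [hF] at h₁
  -- Step 2: c1's coordinate-linear map onto `COR(G_g)`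
  have h₂ := hasEFOfSize_image_add h₁ (corMap r g hg)
  rw [corMap_image_queueGridPP, LinearMap.image_convexHull, ← Set.range_comp,
    ← Summit.ValiantsHypothesis.ValiantsHypothesis.Theorems.FifoMatching.QueueGridFace.corPolytopeGraph_eq] at h₂
  have hV₂ : ∀ j j', π₁ j = π₁ j' →
      (⇑(corMap r g hg) ∘ q₁) j - (⇑(corMap r g hg) ∘ q₁) j' ∈ V₁.map (corMap r g hg) := by
    intro j j' hπ
    refine ⟨q₁ j - q₁ j', hV₁ j j' hπ, ?_⟩
    simp [map_sub]
  have hd₂ : Module.finrank ℝ ↥(V₁.map (corMap r g hg)) ≤ Module.finrank ℝ ↥V₁ :=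
    Submodule.finrank_map_le _ _
  -- Step 3: AFHMS's face of `COR(G_g)` onto `COR(K_h)`, as ONE valid functional
  obtain ⟨h, hch, k, cv, δ, πA, hvalid, hπA⟩ := hface g ht
  obtain ⟨K₃, q₃, π₃, V₃, h₃, hV₃, hd₃⟩ := transport_step_flats (⇑(corMap r g hg) ∘ q₁) π₁ _ hV₂ h₂
    (∑ i, cv i) (∑ i, δ i) (sum_dotProduct_le_sum_of_valid _ cv δ hvalid) πA
  rw [← inter_eqs_eq_inter_sum_of_valid _ cv δ hvalid, hπA] at h₃
  exact ⟨h, hch, K₃, q₃, π₃, V₃, h₃, hV₃, hd₃.trans (hd₂.trans hd₁)⟩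

/-! ## §2 The route rate at the COR level -/


/-- halving the scale costs one unit of `c`: `T c h ≤ T (c+1) (h/2)`. [folklore] -/
theorem T_le_T_succ_half (c h : ℕ) :
    2 ^ ((Nat.log 2 h + c) ^ c) ≤ 2 ^ ((Nat.log 2 (h / 2) + (c + 1)) ^ (c + 1)) := by
  apply Nat.pow_le_pow_right (by norm_num)
  have hlog : Nat.log 2 h ≤ Nat.log 2 (h / 2) + 1 := by
    rw [Nat.log_div_base]
    omega
  calc (Nat.log 2 h + c) ^ c ≤ (Nat.log 2 (h / 2) + (c + 1)) ^ c := Nat.pow_le_pow_left (by omega) c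
    _ ≤ (Nat.log 2 (h / 2) + (c + 1)) ^ (c + 1) :=
        Nat.pow_le_pow_right (by omega) (Nat.le_succ c)

/-- ★★ **COR level, passengers on few parallel low-dimensional flats (PROVED):** for every `c`, eventually in `h`, every family
`q : J → ℝ^{h×h}` on `|T|` parallel translates of a direction space `V` with `2·dim V ≤ h` and
`|T| · 2^{h/2 − ⌊(h/2)/2⌋} ≤ 3^{h/2 − ⌊(h/2)/2⌋}` (read: `|T| ≤ 1.22^{h/2}`) gives `xc(COR(K_h) + conv q) > 2^((log₂ h + c)^c)`.
[cite: KaibelWeltge2014, Thm. 1] -/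
theorem corMinkowskiHard_fewFlats (c : ℕ) : ∃ h₀ : ℕ, ∀ h ≥ h₀, ∀ {J T : Type} [Fintype J] [Nonempty J] [Fintype T]
    (q : J → (Fin h × Fin h → ℝ)) (π : J → T) (V : Submodule ℝ (Fin h × Fin h → ℝ)) (r : ℕ),
      (∀ j j', π j = π j' → q j - q j' ∈ V) → 2 * Module.finrank ℝ ↥V ≤ h →
      Fintype.card T * 2 ^ (h / 2 - (h / 2) / 2) ≤ 3 ^ (h / 2 - (h / 2) / 2) →
      HasEFOfSize (corPolytopeGraph (⊤ : SimpleGraph (Fin h)) + convexHull ℝ (Set.range q)) r →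
        2 ^ ((Nat.log 2 h + c) ^ c) < r := by
  obtain ⟨r₀, hr₀2, hgrowth⟩ := growth_eventually (c + 1) (c := (1 / 2 : ℝ)) (by norm_num)
  refine ⟨2 * r₀ + 2, fun h hh J T _ _ _ q π V r hV hdim hgen hEF => ?_⟩
  classical
  have hflats := corPolytopeGraph_top_add_hull_three_pow_le_of_flats q π V hV hEF
  -- descend to the half level `h/2 ≤ h - dim V`
  have hhalf : 3 ^ (h / 2) ≤ Fintype.card T * (r + 1) * 2 ^ (h / 2) :=
    three_two_descend (by omega) hflats
  have hk : 3 ^ ((h / 2) / 2) ≤ (r + 1) * 2 ^ ((h / 2) / 2) := three_pow_half_le hhalf hgen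
  have hkR : (3 : ℝ) ^ ((h / 2) / 2) ≤ ((r : ℝ) + 1) * 2 ^ ((h / 2) / 2) := by exact_mod_cast hk
  have h32 : ((3 : ℝ) / 2) ^ ((h / 2) / 2) ≤ (r : ℝ) + 1 := by
    rw [div_pow, div_le_iff₀ (by positivity)]
    exact hkR
  have hsqrt : (2 : ℝ) ^ ((1 / 2 : ℝ) * (((h / 2) / 2 : ℕ) : ℝ)) ≤ ((3 : ℝ) / 2) ^ ((h / 2) / 2) := by
    rw [Real.rpow_mul (by norm_num), Real.rpow_natCast]
    refine pow_le_pow_left₀ (by positivity) ?_ _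
    rw [← Real.sqrt_eq_rpow]
    calc Real.sqrt 2 ≤ Real.sqrt (((3 : ℝ) / 2) ^ 2) := Real.sqrt_le_sqrt (by norm_num)
      _ = 3 / 2 := Real.sqrt_sq (by norm_num)
  have hg := hgrowth (h / 2) (by omega)
  have hT : (((2 ^ ((Nat.log 2 (h / 2) + (c + 1)) ^ (c + 1)) : ℕ) : ℕ) : ℝ) =
      (2 : ℝ) ^ ((Nat.log 2 (h / 2) + (c + 1)) ^ (c + 1)) := by
    push_cast; ring
  have h4 : (1 : ℝ) ≤ ((h / 2 : ℕ) : ℝ) ^ 4 :=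
    one_le_pow₀ (by exact_mod_cast (show 1 ≤ h / 2 by omega))
  have hlt : (((2 ^ ((Nat.log 2 (h / 2) + (c + 1)) ^ (c + 1)) : ℕ) : ℕ) : ℝ) < r := by
    rw [hT]
    by_contra hcon
    push Not at hcon
    linarith
  have hlt' : 2 ^ ((Nat.log 2 (h / 2) + (c + 1)) ^ (c + 1)) < r := by exact_mod_cast hlt
  exact lt_of_le_of_lt (T_le_T_succ_half c h) hlt'

/-! ## §3 In the crux's currency -/

/-- ★★★ **`NNDivisionHard` ON THE COFACTORS WHOSE NEWTON POLYTOPE IS GENERATED BY POINTS ON AT MOST `2^{κ√n}` PARALLEL FLATS OF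
DIMENSION `≤ κ√n` (PROVED, unconditional):** `∃ κ > 0, ∀ c`, eventually in `n`, every `hh ≠ 0` over `ℝ≥0` whose Newton polytope is
the hull of a family `q₀ : J → ℝ^{2n×2n}` labelled by `π : J → T`, `|T| ≤ 2^{κ·√n}`, with equal-label differences in a space `V` of
dimension `≤ κ·√n`, satisfies `2^((log₂ n + c)^c) < L₊(NN_n · hh) + L₊(hh)` — any degrees, any number of monomials or vertices, any
Newton dimension.  (`V = ⊥`: `…nnDivisionHard_fewGeneratorsExp`; `|T| = 1`: `…nnDivisionHard_lowdim`, up to constants.)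
[cite: HrubesYehudayoff2021, §6 Problem 2] [cite: KaibelWeltge2014, Thm. 1] -/
theorem nnDivisionHard_fewFlatsExp : ∃ κ : ℝ, 0 < κ ∧ ∀ c : ℕ, ∃ n₀ : ℕ, ∀ n ≥ n₀,
    ∀ hh : MvPolynomial (Fin (2 * n) × Fin (2 * n)) ℝ≥0, hh ≠ 0 →
      ∀ {J T : Type} [Fintype J] [Nonempty J] [Fintype T] (q₀ : J → (Fin (2 * n) × Fin (2 * n)) → ℝ)
        (π : J → T) (V : Submodule ℝ ((Fin (2 * n) × Fin (2 * n)) → ℝ)),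
        newtonPolytope (MvPolynomial.map NNReal.toRealHom hh) = convexHull ℝ (Set.range q₀) →
        (∀ j j', π j = π j' → q₀ j - q₀ j' ∈ V) →
        (Fintype.card T : ℝ) ≤ (2 : ℝ) ^ (κ * Real.sqrt n) →
        (Module.finrank ℝ ↥V : ℝ) ≤ κ * Real.sqrt n →
          2 ^ ((Nat.log 2 n + c) ^ c) < complexity (nestFreeMatchingPoly n ℝ≥0 * hh) + complexity hh := by
  obtain ⟨cA, hcA, t₀, htrans⟩ := transport_geometric_flats
  set cm : ℝ := min cA 1 with hcm
  have hcm0 : 0 < cm := lt_min hcA one_pos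
  have hcmA : cm ≤ cA := min_le_left _ _
  have hcm1 : cm ≤ 1 := min_le_right _ _
  refine ⟨cm / 256, by positivity, fun c => ?_⟩
  obtain ⟨h₀, hh₀⟩ := corMinkowskiHard_fewFlats (4 ^ (c + 1) + c + 1)
  obtain ⟨S₁, hS₁⟩ := exists_nat_ge ((20 / cm) ^ 2)
  obtain ⟨S₀, hS₀a, hS₀b, hS₀c, hS₀d⟩ :
      ∃ S₀ : ℕ, 4 * t₀ + 4 ≤ S₀ ∧ h₀ ^ 2 ≤ S₀ ∧ S₁ ≤ S₀ ∧ 16 ≤ S₀ :=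
    ⟨4 * t₀ + 4 + h₀ ^ 2 + S₁ + 16, by omega, by omega, by omega, by omega⟩
  refine ⟨S₀ ^ 2, fun n hn hh hh0 J T _ _ _ q₀ π V hQ hV hcard hdimV => ?_⟩
  classical
  by_contra hle
  push Not at hle
  have hEF : HasEFOfSize (newt (nestFreeMatchingPoly n ℝ≥0) + convexHull ℝ (Set.range q₀))
      (3 * 2 ^ ((Nat.log 2 n + c) ^ c)) := by
    have h1 := hasEFOfSize_newtonPolytope_complexity (nestFreeMatchingPoly n ℝ≥0 * hh)
    rw [map_mul, newtonPolytope_mul, hQ, ← newt_eq_newtonPolytope] at h1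
    exact h1.of_le (by omega)
  obtain ⟨s, hs⟩ : ∃ s, s = Nat.sqrt n := ⟨_, rfl⟩
  have hsS : S₀ ≤ s := by rw [hs]; exact Nat.le_sqrt'.2 hn
  have hss : s ^ 2 ≤ n := by rw [hs]; exact Nat.sqrt_le' n
  have hns : n < (s + 1) ^ 2 := by rw [hs]; exact Nat.lt_succ_sqrt' n
  obtain ⟨g, hg⟩ : ∃ g, g = s / 4 := ⟨_, rfl⟩
  have h4g : 4 * g ≤ s := by rw [hg]; exact Nat.mul_div_le s 4
  have hg4 : s < 4 * (g + 1) := by rw [hg]; omega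
  have hg1 : 1 ≤ g := by omega
  have hgt : t₀ ≤ g := by omega
  have hn' : (2 * g + 1) * (2 * (2 * g) + 1) ≤ n := by nlinarith [Nat.mul_le_mul h4g h4g]
  obtain ⟨h, hch, K, q, π', V', hEF', hV', hdV'⟩ :=
    htrans n (2 * g) g (by omega) hn' (le_refl _) hgt q₀ π V hV (3 * 2 ^ ((Nat.log 2 n + c) ^ c)) hEF
  have hsqrt_s : Real.sqrt s * Real.sqrt s = s := Real.mul_self_sqrt (Nat.cast_nonneg s)
  have hg_real : (s : ℝ) / 4 - 1 ≤ g := by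
    have : (s : ℝ) < 4 * ((g : ℝ) + 1) := by exact_mod_cast hg4
    linarith
  have h1 : cm * ((s : ℝ) / 4 - 1) ≤ h :=
    calc cm * ((s : ℝ) / 4 - 1) ≤ cm * g := mul_le_mul_of_nonneg_left hg_real hcm0.le
      _ ≤ cA * g := mul_le_mul_of_nonneg_right hcmA (Nat.cast_nonneg g)
      _ ≤ h := hch
  have hreal : Real.sqrt s + 1 ≤ (h : ℝ) := by
    have hS₁s : ((20 / cm) ^ 2 : ℝ) ≤ s := le_trans hS₁ (by exact_mod_cast (show S₁ ≤ s by omega))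
    have hsq : 20 / cm ≤ Real.sqrt s := by
      rw [show (20 / cm : ℝ) = Real.sqrt ((20 / cm) ^ 2) by rw [Real.sqrt_sq (by positivity)]]
      exact Real.sqrt_le_sqrt hS₁s
    have h20 : 20 ≤ cm * Real.sqrt s := by
      have := mul_le_mul_of_nonneg_left hsq hcm0.le
      rwa [show cm * (20 / cm) = 20 by field_simp] at this
    have h2 : 20 * Real.sqrt s ≤ cm * s := by
      have := mul_le_mul_of_nonneg_right h20 (Real.sqrt_nonneg s)
      rw [mul_assoc, hsqrt_s] at this
      exact this
    have hs1 : 1 ≤ Real.sqrt s := by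
      rw [show (1 : ℝ) = Real.sqrt 1 by simp]
      exact Real.sqrt_le_sqrt (by exact_mod_cast (show 1 ≤ s by omega))
    nlinarith
  have hh₀' : h₀ ≤ h := by
    have : (h₀ : ℝ) ≤ Real.sqrt s := by
      rw [show (h₀ : ℝ) = Real.sqrt ((h₀ : ℝ) ^ 2) by rw [Real.sqrt_sq (Nat.cast_nonneg _)]]
      exact Real.sqrt_le_sqrt (by exact_mod_cast (show h₀ ^ 2 ≤ s by omega))
    exact_mod_cast (by linarith : (h₀ : ℝ) ≤ h)
  have hn4 : n < h ^ 4 := by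
    have hs1 : s + 1 ≤ h ^ 2 := by
      have : (s : ℝ) + 1 ≤ (h : ℝ) ^ 2 := by nlinarith [Real.sqrt_nonneg s]
      exact_mod_cast this
    calc n < (s + 1) ^ 2 := hns
      _ ≤ (h ^ 2) ^ 2 := Nat.pow_le_pow_left hs1 2
      _ = h ^ 4 := by rw [← pow_mul]
  have hn0 : n ≠ 0 := by
    have : 16 ^ 2 ≤ s ^ 2 := Nat.pow_le_pow_left (by omega) 2
    omega
  -- the side conditions of `corMinkowskiHard_fewFlats`: `x := (cm/256)·√n` has `4x ≤ h/2` (nat floor) and `2·dim V' ≤ h`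
  have hsqn : Real.sqrt n ≤ (s : ℝ) + 1 := by
    calc Real.sqrt n ≤ Real.sqrt (((s : ℝ) + 1) ^ 2) :=
          Real.sqrt_le_sqrt (by exact_mod_cast hns.le)
      _ = (s : ℝ) + 1 := Real.sqrt_sq (by positivity)
  have hs16 : (16 : ℝ) ≤ s := by exact_mod_cast (show 16 ≤ s by omega)
  have hx16 : 16 * (cm / 256 * Real.sqrt n) ≤ h := by
    have e1 : cm / 256 * Real.sqrt n ≤ cm / 256 * ((s : ℝ) + 1) :=
      mul_le_mul_of_nonneg_left hsqn (by positivity)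
    nlinarith
  have hhalf_real : ((h : ℝ) - 1) / 2 ≤ ((h / 2 : ℕ) : ℝ) := by
    have : h ≤ 2 * (h / 2) + 1 := by omega
    have : (h : ℝ) ≤ 2 * ((h / 2 : ℕ) : ℝ) + 1 := by exact_mod_cast this
    linarith
  have hs1 : (1 : ℝ) ≤ Real.sqrt s := Real.one_le_sqrt.2 (by exact_mod_cast (show 1 ≤ s by omega))
  have h2h : (2 : ℝ) ≤ h := by linarith
  have hx4 : 4 * (cm / 256 * Real.sqrt n) ≤ ((h / 2 : ℕ) : ℝ) := by linarith
  have hgen : Fintype.card T * 2 ^ (h / 2 - (h / 2) / 2) ≤ 3 ^ (h / 2 - (h / 2) / 2) :=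
    card_side_condition (m := Fintype.card T) (h := h / 2) hcard hx4
  have hdimR : (2 : ℝ) * (Module.finrank ℝ ↥V : ℝ) ≤ h := by linarith
  have hdim2 : 2 * Module.finrank ℝ ↥V ≤ h := by exact_mod_cast hdimR
  have hdim : 2 * Module.finrank ℝ ↥V' ≤ h := le_trans (Nat.mul_le_mul_left 2 hdV') hdim2
  have hT := T_pow_four_le (c := c) hn0 hn4
  have hlt := hh₀ h hh₀' q π' V' (3 * 2 ^ ((Nat.log 2 n + c) ^ c)) hV' hdim hgen hEF'
  have hT2 : 2 ≤ 2 ^ ((Nat.log 2 n + c) ^ c) := by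
    show 2 ^ 1 ≤ 2 ^ _
    exact Nat.pow_le_pow_right (by norm_num)
      (Nat.one_le_pow _ _ (by
        have h256 : 16 ^ 2 ≤ S₀ ^ 2 := Nat.pow_le_pow_left hS₀d 2
        have := Nat.log_pos one_lt_two (show 2 ≤ n by omega)
        omega))
  have h8 : 8 * 2 ^ ((Nat.log 2 n + c) ^ c) ≤ (2 ^ ((Nat.log 2 n + c) ^ c)) ^ 4 := by
    have : 2 ^ 3 ≤ (2 ^ ((Nat.log 2 n + c) ^ c)) ^ 3 := Nat.pow_le_pow_left hT2 3
    calc 8 * 2 ^ ((Nat.log 2 n + c) ^ c) = 2 ^ 3 * 2 ^ ((Nat.log 2 n + c) ^ c) := by norm_num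
      _ ≤ (2 ^ ((Nat.log 2 n + c) ^ c)) ^ 3 * 2 ^ ((Nat.log 2 n + c) ^ c) := Nat.mul_le_mul_right _ this
      _ = (2 ^ ((Nat.log 2 n + c) ^ c)) ^ 4 := by ring
  omega

/-- the support points of a product lie on `|supp p|` parallel translates of the direction space of `supp q`:
`Newt(p · q) = conv{realOf a + realOf b : a ∈ supp p, b ∈ supp q}` (over `ℝ≥0` there is no cancellation to worry about:
`Newt(p·q) = Newt p + Newt q`). [folklore] -/
theorem newtonPolytope_mul_eq_convexHull_range {n : ℕ} (p q : MvPolynomial (Fin (2 * n) × Fin (2 * n)) ℝ≥0) :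
    newtonPolytope (MvPolynomial.map NNReal.toRealHom (p * q)) =
      convexHull ℝ (Set.range fun ab : p.support × q.support =>
        realOf (σ := Fin (2 * n) × Fin (2 * n)) ab.1.1 + realOf (σ := Fin (2 * n) × Fin (2 * n)) ab.2.1) := by
  rw [map_mul, newtonPolytope_mul, ← newt_eq_newtonPolytope, ← newt_eq_newtonPolytope]
  unfold newt
  rw [← convexHull_add]
  congr 1
  ext y
  simp only [Set.mem_add, Set.mem_range, suppPts, Set.mem_image, Finset.mem_coe]
  constructor
  · rintro ⟨_, ⟨a, ha, rfl⟩, _, ⟨b, hb, rfl⟩, rfl⟩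
    exact ⟨(⟨a, ha⟩, ⟨b, hb⟩), rfl⟩
  · rintro ⟨ab, rfl⟩
    exact ⟨realOf ab.1.1, ⟨ab.1.1, ab.1.2, rfl⟩, realOf ab.2.1, ⟨ab.2.1, ab.2.2, rfl⟩, rfl⟩

/-- ★★★ **PRODUCTS OF A FEW-NOMIAL AND A LOW-DIMENSIONAL COFACTOR ARE NOT CERTIFICATES (PROVED, unconditional):** `∃ κ > 0, ∀ c`,
eventually in `n`, every product `p · q ≠ 0` over `ℝ≥0` with `|supp p| ≤ 2^{κ·√n}` and `dim aff supp q ≤ κ·√n` satisfies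
`2^((log₂ n + c)^c) < L₊(NN_n · (p·q)) + L₊(p·q)` — any degrees of `p` and `q`; `Newt(p·q)` may have `|supp p| · #vert Newt(q)`
vertices and dimension `dim Newt p + dim Newt q`, so neither the generator-count tier nor the dimension tier decides this class.
[cite: HrubesYehudayoff2021, §6 Problem 2] [cite: KaibelWeltge2014, Thm. 1] -/
theorem nnDivisionHard_mul_fewMonomials_lowdim : ∃ κ : ℝ, 0 < κ ∧ ∀ c : ℕ, ∃ n₀ : ℕ, ∀ n ≥ n₀,
    ∀ p q : MvPolynomial (Fin (2 * n) × Fin (2 * n)) ℝ≥0, p * q ≠ 0 →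
      (p.support.card : ℝ) ≤ (2 : ℝ) ^ (κ * Real.sqrt n) → (adim (suppPts q) : ℝ) ≤ κ * Real.sqrt n →
        2 ^ ((Nat.log 2 n + c) ^ c) <
          complexity (nestFreeMatchingPoly n ℝ≥0 * (p * q)) + complexity (p * q) := by
  obtain ⟨κ, hκ, H⟩ := nnDivisionHard_fewFlatsExp
  refine ⟨κ, hκ, fun c => ?_⟩
  obtain ⟨n₀, hn₀⟩ := H c
  refine ⟨n₀, fun n hn p q hpq hcard hdim => ?_⟩
  classical
  have hp0 : p ≠ 0 := left_ne_zero_of_mul hpq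
  have hq0 : q ≠ 0 := right_ne_zero_of_mul hpq
  haveI : Nonempty p.support := (MvPolynomial.support_nonempty.2 hp0).coe_sort
  haveI : Nonempty q.support := (MvPolynomial.support_nonempty.2 hq0).coe_sort
  have hS : suppPts q = Set.range fun b : q.support => realOf (σ := Fin (2 * n) × Fin (2 * n)) b.1 := by
    unfold suppPts; rw [Set.image_eq_range]; rfl
  refine hn₀ n hn (p * q) hpq
    (fun ab : p.support × q.support =>
      realOf (σ := Fin (2 * n) × Fin (2 * n)) ab.1.1 + realOf (σ := Fin (2 * n) × Fin (2 * n)) ab.2.1)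
    (fun ab => ab.1) (vectorSpan ℝ (suppPts q)) (newtonPolytope_mul_eq_convexHull_range p q) ?_ ?_ hdim
  · intro a b hab
    rw [hS]
    exact add_flats (fun a : p.support => realOf (σ := Fin (2 * n) × Fin (2 * n)) a.1)
      (fun b : q.support => realOf (σ := Fin (2 * n) × Fin (2 * n)) b.1) a b hab
  · rwa [Fintype.card_coe]

end FewFlats

end Summit.ValiantsHypothesis.ValiantsHypothesis.Theorems.FifoMatching

end
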